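import Summits.ResolutionOfSingularities.ResolutionOfSingularities.Theorems.EquisingularLiftEquisingularLiftSmoothNhdOfGoodAt
import Summits.ResolutionOfSingularities.ResolutionOfSingularities.Theorems.EquisingularLiftEquisingularLiftSectionHorizCentre
import HarnessLib

/-!
# [OURS · L1 W4.5(b)] EL♮ `EquisingularLiftNat` (stmt-ResolutionOfSingularities-20038), line `sections` — GOOD POINTS AND
# SECTIONS (`T_sec` of CRUX-PLAN v3 §4): «a section through `x` exists iff `x` is good»

Helper file `--supports stmt-ResolutionOfSingularities-20038` (toolkit for the carrier game of `stub_elnat_three`; res-L1-w45b-plan-1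
CRUX-PLAN v3 §1.1 «BAD POINTS: b ∈ P_{i,k} with ϖ ∈ 𝔪²_{P_i,b} …; a section through x exists iff x is good» and §4 «T_sec
`section_goodPoint` (good ⟺ ϖ ∉ 𝔪²; section exists, regular, O-smooth, special support {x})»). NOT a statement of any manuscript;
OURS plumbing over the w45b toolkit. «Good reduction at `x`» is the route's `Split.GoodAt r x` (Theorems/EquisingularLiftDefs.lean),
spelled INLINE here (its definiens, so `GoodAt r x` is accepted by `exact`/defeq and this file stays outside the Theses cone):
`𝒪_{X,x}` regular and, for every uniformizer `ϖ` of `O`, the germ at `x` of `r♯(ϖ)` outside `𝔪_x²`.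

* `Γgerm_notMem_sq_of_section` — **NECESSITY: a point carrying a section is good.** For a DVR `O`, any `r : X → Spec O` and any
  section `s` (`s ≫ r = 𝟙`), the germ at `x = s(s₀)` of `r♯(ϖ)` is NOT in `𝔪_x²`: the stalk map of `s` at `s₀` is a local
  homomorphism `θ : 𝒪_{X,x} → 𝒪_{Spec O,s₀} = O` with `θ(germ r♯ϖ) = ϖ` (because `s♯ ∘ r♯ = id` on global sections), and a local
  homomorphism maps `𝔪_x²` into `𝔪_O² = (ϖ²) ∌ ϖ`. No regularity, flatness or finiteness hypothesis is needed.
* `goodAt_of_section` — hence `GoodAt r (s s₀)` as soon as `𝒪_{X, s s₀}` is regular; `not_exists_section_of_Γgerm_mem_sq` —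
  contrapositive: through a BAD point (`germ r♯ϖ ∈ 𝔪_x²` for some uniformizer) there is no section.
* `exists_section_of_goodAt` — **SUFFICIENCY: through a good closed point there is a section.** For a complete DVR `O` with
  algebraically closed residue field and `r : X → Spec O` separated, flat and locally of finite presentation: a CLOSED point `x`
  of the special fibre with `GoodAt r x` carries a section `s` (`s s₀ = x`) whose centre `V(ker s)` is regular, flat over `O`, and
  meets the special fibre only in `x` — composition of `exists_smooth_nhd_of_goodAt` (fibrewise smoothness criterion, p164751)
  and `exists_section_horizCentre` (Hensel, EGA IV₄ 18.5.17, p465332-class).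

Together with `…NatSectionStep` (p497593: section centres are E1-admissible) this is the complete `T_sec` package.
-/

set_option linter.dupNamespace false -- mandated namespace `Summit.<Summit>.<Problem>` of this single-conjunct summit
set_option linter.overlappingInstances false -- signatures carry `[IsDomain O] [IsDiscreteValuationRing O]`

noncomputable section

open CategoryTheory CategoryTheory.Limits AlgebraicGeometry TopologicalSpace Topology
open IsLocalRing Literature.AlgebraicGeometry.Resolution
open Summit.ResolutionOfSingularities.ResolutionOfSingularities.Cruxes.EquisingularLift.StrataSplit

namespace Summit.ResolutionOfSingularities.ResolutionOfSingularities.Cruxes.EquisingularLiftNat.Sections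

/-! ## Necessity: a point carrying a section is good -/

/-- In a DVR a uniformizer is not in the square of the maximal ideal. [folklore] -/
theorem notMem_maximalIdeal_sq_of_irreducible {O : Type} [CommRing O] [IsDomain O] [IsDiscreteValuationRing O]
    {ϖ : O} (hϖ : Irreducible ϖ) : ϖ ∉ (maximalIdeal O) ^ 2 := by
  rw [hϖ.maximalIdeal_eq, Ideal.span_singleton_pow, Ideal.mem_span_singleton]
  rintro ⟨c, hc⟩
  apply hϖ.not_isUnit
  have hϖ0 : ϖ ≠ 0 := hϖ.ne_zero
  have h1 : ϖ * 1 = ϖ * (ϖ * c) := by rw [mul_one, ← mul_assoc, ← pow_two]; exact hc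
  exact IsUnit.of_mul_eq_one c (mul_left_cancel₀ hϖ0 h1).symm

/-- **A point carrying a section is good (necessity half of «a section through `x` exists iff `x` is good»).** Let `O` be a
DVR with uniformizer `ϖ`, `r : X → Spec O` any morphism and `s` a section of `r`. Then the germ at `s(s₀)` of the global
section `r♯(ϖ)` does not lie in `𝔪_{s(s₀)}²`: the stalk map of `s` at the closed point `s₀` is a local homomorphism
`𝒪_{X,s(s₀)} → 𝒪_{Spec O,s₀} ≅ O` sending that germ to `ϖ ∉ 𝔪_O² = (ϖ²)`. [folklore] -/
theorem Γgerm_notMem_sq_of_section (O : Type) [CommRing O] [IsDomain O] [IsDiscreteValuationRing O]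
    {X : Scheme.{0}} (r : X ⟶ Spec (.of O)) (s : Spec (.of O) ⟶ X) (hs : s ≫ r = 𝟙 _)
    {ϖ : O} (hϖ : Irreducible ϖ) :
    (X.presheaf.Γgerm (s (closedPoint O))).hom (r.appTop.hom ((Scheme.ΓSpecIso (.of O)).inv.hom ϖ)) ∉
      (maximalIdeal (X.presheaf.stalk (s (closedPoint O)))) ^ 2 := by
  set pt := closedPoint O with hpt
  set x := s pt with hx
  -- the local rings `S = 𝒪_{X,x}` and `R = 𝒪_{Spec O, pt} ≅ O`, and the local homomorphism `θ = s^♯_pt : S → R`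
  set S := X.presheaf.stalk x
  set R := (Spec (.of O)).presheaf.stalk pt
  let θ : S →+* R := (s.stalkMap pt).hom
  haveI : IsLocalHom θ := inferInstanceAs (IsLocalHom (s.stalkMap pt).hom)
  letI : Algebra O R := StructureSheaf.stalkAlgebra O pt
  haveI : IsLocalization.AtPrime R pt.asIdeal := StructureSheaf.IsLocalization.to_stalk O pt
  have hunits : pt.asIdeal.primeCompl ≤ IsUnit.submonoid O := fun y hy => not_not.mp hy
  let eOR : O ≃ₐ[O] R := IsLocalization.atUnits O pt.asIdeal.primeCompl hunits
  have heOR : ∀ y : O, eOR y = algebraMap O R y := fun y => by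
    simpa using eOR.commutes y
  -- `θ (germ_x (r♯ ϖ)) = germ_pt (s♯ r♯ ϖ) = germ_pt ϖ = algebraMap O R ϖ`
  set ϖ₀ : Γ(Spec (.of O), ⊤) := (Scheme.ΓSpecIso (.of O)).inv.hom ϖ with hϖ₀
  have happ : s.appTop.hom (r.appTop.hom ϖ₀) = ϖ₀ := by
    have h := congrArg (fun f : Spec (.of O) ⟶ Spec (.of O) => f.appTop.hom ϖ₀) hs
    simpa only [Scheme.Hom.comp_appTop, Scheme.Hom.id_appTop, CommRingCat.hom_comp, CommRingCat.hom_id,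
      RingHom.comp_apply, RingHom.id_apply] using h
  have hθg : θ ((X.presheaf.Γgerm x).hom (r.appTop.hom ϖ₀)) = algebraMap O R ϖ := by
    show (s.stalkMap pt).hom ((X.presheaf.Γgerm (s pt)).hom (r.appTop.hom ϖ₀)) = _
    rw [stalkMap_Γgerm_apply' s pt, happ, algebraMap_stalk_eq_Γgerm]
  -- a local homomorphism maps `𝔪_S²` into `𝔪_R²`
  intro hmem
  have hmapm : (maximalIdeal S).map θ ≤ maximalIdeal R := by
    refine Ideal.map_le_iff_le_comap.mpr fun a ha => ?_
    exact map_nonunit θ a ha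
  have hmem' : algebraMap O R ϖ ∈ (maximalIdeal R) ^ 2 := by
    rw [← hθg]
    have h2 : θ ((X.presheaf.Γgerm x).hom (r.appTop.hom ϖ₀)) ∈ ((maximalIdeal S) ^ 2).map θ :=
      Ideal.mem_map_of_mem θ hmem
    rw [Ideal.map_pow] at h2
    exact Ideal.pow_right_mono hmapm 2 h2
  -- `𝔪_R² = (𝔪_O²)·R` and `O → R` is bijective, so `ϖ ∈ 𝔪_O²`: impossible for a uniformizer
  have hmR : maximalIdeal R = (maximalIdeal O).map (algebraMap O R) :=
    (IsLocalization.AtPrime.map_eq_maximalIdeal pt.asIdeal R).symm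
  rw [hmR, ← Ideal.map_pow] at hmem'
  have hsurj : Function.Surjective (algebraMap O R) := fun y => ⟨eOR.symm y, by rw [← heOR, AlgEquiv.apply_symm_apply]⟩
  have hinj : Function.Injective (algebraMap O R) := fun a b hab => by
    apply eOR.injective
    rw [heOR, heOR, hab]
  obtain ⟨y, hy, hyϖ⟩ := (Ideal.mem_map_iff_of_surjective (algebraMap O R) hsurj).mp hmem'
  obtain rfl : y = ϖ := hinj hyϖ
  exact notMem_maximalIdeal_sq_of_irreducible hϖ hy

/-- **Sections only pass through good points**: if `s` is a section of `r : X → Spec O` (`O` a DVR) and `𝒪_{X, s(s₀)}` is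
regular, then the ambient has good reduction at `s(s₀)` (`GoodAt`, Theorems/EquisingularLiftDefs.lean). [folklore] -/
theorem goodAt_of_section (O : Type) [CommRing O] [IsDomain O] [IsDiscreteValuationRing O] {X : Scheme.{0}}
    (r : X ⟶ Spec (.of O)) (s : Spec (.of O) ⟶ X) (hs : s ≫ r = 𝟙 _)
    (hreg : IsRegularLocalRing (X.presheaf.stalk (s (closedPoint O)))) :
    IsRegularLocalRing (X.presheaf.stalk (s (closedPoint O))) ∧
      ∀ ϖ : O, Irreducible ϖ → (X.presheaf.Γgerm (s (closedPoint O))).hom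
        (r.appTop.hom ((Scheme.ΓSpecIso (CommRingCat.of O)).inv.hom ϖ)) ∉
        (maximalIdeal (X.presheaf.stalk (s (closedPoint O)))) ^ 2 :=
  ⟨hreg, fun _ϖ hϖ => Γgerm_notMem_sq_of_section O r s hs hϖ⟩

/-- **Through a bad point there is no section** (contrapositive of `Γgerm_notMem_sq_of_section`): if for some uniformizer
`ϖ` the germ of `r♯(ϖ)` at `x` lies in `𝔪_x²` (e.g. `x` a singular point of the special fibre of a regular `X`), then no
section of `r` passes through `x`. [folklore] -/
theorem not_exists_section_of_Γgerm_mem_sq (O : Type) [CommRing O] [IsDomain O] [IsDiscreteValuationRing O]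
    {X : Scheme.{0}} (r : X ⟶ Spec (.of O)) (x : X) {ϖ : O} (hϖ : Irreducible ϖ)
    (hbad : (X.presheaf.Γgerm x).hom (r.appTop.hom ((Scheme.ΓSpecIso (.of O)).inv.hom ϖ)) ∈
      (maximalIdeal (X.presheaf.stalk x)) ^ 2) :
    ¬ ∃ s : Spec (.of O) ⟶ X, s ≫ r = 𝟙 _ ∧ s (closedPoint O) = x := by
  rintro ⟨s, hs, rfl⟩
  exact Γgerm_notMem_sq_of_section O r s hs hϖ hbad

/-! ## Sufficiency: through a good closed point there is a section -/

/-- **Through a good closed point there is a section (sufficiency half), with its centre facts.** Let `O` be a complete DVR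
with algebraically closed residue field, `r : X → Spec O` separated, flat and locally of finite presentation, and `x` a CLOSED
point of `X` on the special fibre at which the ambient has good reduction (`GoodAt r x`). Then there is a section `s` of `r`
with `s(s₀) = x`; its centre `V(ker s) ≅ Spec O` is regular and flat over `O`, and no other point of the special fibre lies on
it (fibrewise smoothness criterion at `x` + Hensel's lemma on the smooth neighbourhood). [cite: Grothendieck1967, Thm. 18.5.17] -/
theorem exists_section_of_goodAt (O : Type) [CommRing O] [IsDomain O] [IsDiscreteValuationRing O]
    [IsAdicComplete (maximalIdeal O) O] [IsAlgClosed (ResidueField O)] (X : Scheme.{0}) (r : X ⟶ Spec (.of O))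
    [IsSeparated r] [LocallyOfFinitePresentation r] [Flat r] (x : X) (hxcl : IsClosed ({x} : Set X))
    (hrx : r x = closedPoint O)
    (hgood : IsRegularLocalRing (X.presheaf.stalk x) ∧
      ∀ ϖ : O, Irreducible ϖ → (X.presheaf.Γgerm x).hom
        (r.appTop.hom ((Scheme.ΓSpecIso (CommRingCat.of O)).inv.hom ϖ)) ∉ (maximalIdeal (X.presheaf.stalk x)) ^ 2) :
    ∃ s : Spec (.of O) ⟶ X, s ≫ r = 𝟙 _ ∧ s (closedPoint O) = x ∧ Scheme.IsRegular s.ker.subscheme ∧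
      Flat (s.ker.subschemeι ≫ r) ∧ ∀ y : X, r y = closedPoint O → y ≠ x → y ∉ (s.ker.support : Set X) := by
  obtain ⟨U, hxU, hU⟩ := exists_smooth_nhd_of_goodAt O X r inferInstance inferInstance x hrx hgood
  exact exists_section_horizCentre O X r U hU x hxcl hxU hrx

end Summit.ResolutionOfSingularities.ResolutionOfSingularities.Cruxes.EquisingularLiftNat.Sections

end
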